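import Mathlib
import Literature.Analysis.Complex.LogOnePlus
import Summits.QuantumFields.BalabanUV.Beta.MultilinearJet

/-!
# MultilinearJetExpLog — `exp`, `log (1 + ·)` and `(·)⁻¹` act on multilinear 3-jets by node 12's truncated series
(an1 node 12c, part 2 of 4)

HONEST FRAMING.  Discharging `BetaPertH` would make Bałaban's UV stability UNCONDITIONAL — a constructive-QFT
result; it is NOT the continuum limit and NOT the Clay problem.  This file discharges nothing of it: pure calculus
over `MultilinearJet` (part 1), Mathlib's `NormedSpace.exp` / `Ring.inverse` and the tree's `logOnePlus`
(`Literature/Analysis/Complex/LogOnePlus`).  ABSOLUTE RULE respected: nothing is cited, nothing is asserted about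
the manuscripts under audit.  [folklore]

## Content

For a germ `h` with jet `q ∈ jets h` (part 1) in a complete normed `ℂ`-algebra `𝔸`:

* `exp_mem_jets`:      if `h(0) = 0` (`c00 q.fst = 0`) then `expT ℂ q ∈ jets (exp ∘ h)`;
* `logOnePlus_mem_jets`: if `g(0) = 1` (`c00 q.fst = 1`) then `logT ℂ q ∈ jets (x ↦ logOnePlus (g x − 1))`;
* `inverse_mem_jets`:  if `g(0) = 1` then `invT q ∈ jets (x ↦ Ring.inverse (g x))`;
* `logOnePlus_mul_inverse_mem_jets`: the combination `log (U · E⁻¹)` ↦ `logT (Φ_U · invT Φ_E)` that defines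
  node 12's `Qjet` / 12b's `QjetAt`, `MjetAt`.

So node 12's truncated series `expT`, `logT`, `invT` on the nilpotent algebra `Rho 𝔸` ARE the jets of the genuine
transcendental functions: the order-`≥ 4` tails (`expTail`, `logTail`, power series in `𝔸` with radius `∞`,
resp. `≥ 1`) multiply a fourth power of the augmentation and are flat by `Rho.nil4`.
-/

noncomputable section

set_option synthInstance.maxHeartbeats 400000

open scoped Topology NNReal ENNReal Nat
open Filter
open Literature.MathematicalPhysics.QuantumFieldTheory.Balaban1983to89.Beta.AveragingThirdJet
open Literature.MathematicalPhysics.QuantumFieldTheory.Balaban1983to89.Beta.AveragingThirdJet.Tau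
open Literature.Analysis.Complex

namespace Summit.QuantumFields.BalabanUV.Beta.MultilinearJet

variable {𝔸 : Type*} [NormedRing 𝔸] [NormedAlgebra ℂ 𝔸]

/-! ## §1 The order-4 tails of the exponential and logarithmic series -/

/-- [folklore] `1/(n+4)!`, the coefficients of `(exp y − 1 − y − y²/2 − y³/6)/y⁴`. -/
def expTailCoeff (n : ℕ) : ℂ := (((n + 4)! : ℕ) : ℂ)⁻¹

/-- [folklore] `(−1)^{n+5}/(n+4)`, the coefficients of `(log(1+y) − y + y²/2 − y³/3)/y⁴`. -/
def logTailCoeff (n : ℕ) : ℂ := logSeriesCoeff (n + 4)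

/-- `‖1/(n+4)!‖ ≤ 1/n!`. -/
theorem norm_expTailCoeff_le (n : ℕ) : ‖expTailCoeff n‖ ≤ ((n ! : ℕ) : ℝ)⁻¹ := by
  rw [expTailCoeff, norm_inv, Complex.norm_natCast]
  exact inv_anti₀ (Nat.cast_pos.2 (Nat.factorial_pos n))
    (by exact_mod_cast Nat.factorial_le (Nat.le_add_right n 4))

/-- The log-tail coefficients have norm `≤ 1`. -/
theorem norm_logTailCoeff_le (n : ℕ) : ‖logTailCoeff n‖ ≤ 1 := norm_logSeriesCoeff_le _

/-- [folklore] The exp-tail series has infinite radius. -/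
theorem expTail_radius : (FormalMultilinearSeries.ofScalars 𝔸 expTailCoeff).radius = ⊤ := by
  refine ENNReal.eq_top_of_forall_nnreal_le fun r => ?_
  refine FormalMultilinearSeries.le_radius_of_bound _ (max 1 ‖(1 : 𝔸)‖ * Real.exp r) fun n => ?_
  rw [FormalMultilinearSeries.ofScalars_norm_eq_mul]
  have h1 : ‖expTailCoeff n‖ * (r : ℝ) ^ n ≤ Real.exp r :=
    calc ‖expTailCoeff n‖ * (r : ℝ) ^ n ≤ ((n ! : ℕ) : ℝ)⁻¹ * (r : ℝ) ^ n :=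
          mul_le_mul_of_nonneg_right (norm_expTailCoeff_le n) (pow_nonneg r.2 n)
      _ = (r : ℝ) ^ n / n ! := by rw [inv_mul_eq_div]
      _ ≤ Real.exp r := Real.pow_div_factorial_le_exp (r : ℝ) r.2 n
  calc ‖expTailCoeff n‖ * ‖ContinuousMultilinearMap.mkPiAlgebraFin ℂ n 𝔸‖ * (r : ℝ) ^ n
      = ‖ContinuousMultilinearMap.mkPiAlgebraFin ℂ n 𝔸‖ * (‖expTailCoeff n‖ * (r : ℝ) ^ n) := by ring
    _ ≤ max 1 ‖(1 : 𝔸)‖ * Real.exp r :=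
        mul_le_mul ContinuousMultilinearMap.norm_mkPiAlgebraFin_le h1 (by positivity) (by positivity)

/-- [folklore] The log-tail series has radius `≥ 1`. -/
theorem one_le_logTail_radius : (1 : ℝ≥0∞) ≤ (FormalMultilinearSeries.ofScalars 𝔸 logTailCoeff).radius := by
  have h := FormalMultilinearSeries.le_radius_of_bound (FormalMultilinearSeries.ofScalars 𝔸 logTailCoeff)
    (max 1 ‖(1 : 𝔸)‖) (r := 1) fun n => by
      rw [FormalMultilinearSeries.ofScalars_norm_eq_mul, NNReal.coe_one, one_pow, mul_one]
      calc ‖logTailCoeff n‖ * ‖ContinuousMultilinearMap.mkPiAlgebraFin ℂ n 𝔸‖ ≤ 1 * max 1 ‖(1 : 𝔸)‖ :=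
            mul_le_mul (norm_logTailCoeff_le n) ContinuousMultilinearMap.norm_mkPiAlgebraFin_le
              (ContinuousMultilinearMap.opNorm_nonneg _) zero_le_one
        _ = max 1 ‖(1 : 𝔸)‖ := one_mul _
  simpa using h

/-- [folklore] The exp tail `Σₙ yⁿ/(n+4)!` (an entire function on `𝔸`). -/
def expTail : 𝔸 → 𝔸 := (FormalMultilinearSeries.ofScalars 𝔸 expTailCoeff).sum

/-- [folklore] The log tail `Σₙ (−1)^{n+5} yⁿ/(n+4)` (analytic on the unit ball of `𝔸`). -/
def logTail : 𝔸 → 𝔸 := (FormalMultilinearSeries.ofScalars 𝔸 logTailCoeff).sum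

/-- Every `y` lies in the ball of convergence of the exp tail. -/
theorem mem_eball_expTail (y : 𝔸) :
    y ∈ Metric.eball (0 : 𝔸) (FormalMultilinearSeries.ofScalars 𝔸 expTailCoeff).radius := by
  rw [expTail_radius]; exact Metric.mem_eball.2 (edist_lt_top _ _)

/-- `‖y‖ < 1` lies in the ball of convergence of the log tail. -/
theorem mem_eball_logTail {y : 𝔸} (hy : ‖y‖ < 1) :
    y ∈ Metric.eball (0 : 𝔸) (FormalMultilinearSeries.ofScalars 𝔸 logTailCoeff).radius := by
  refine Metric.mem_eball.2 (lt_of_lt_of_le ?_ one_le_logTail_radius)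
  rw [edist_zero_right, ← ofReal_norm]
  exact_mod_cast ENNReal.ofReal_lt_one.2 hy

variable [CompleteSpace 𝔸]

/-- The exp-tail series sums to `expTail y`. -/
theorem hasSum_expTail (y : 𝔸) : HasSum (fun n => expTailCoeff n • y ^ n) (expTail y) := by
  unfold expTail
  have h := (FormalMultilinearSeries.ofScalars 𝔸 expTailCoeff).hasSum (mem_eball_expTail y)
  simp only [FormalMultilinearSeries.ofScalars_apply_eq] at h
  exact h

/-- The log-tail series sums to `logTail y` on `‖y‖ < 1`. -/
theorem hasSum_logTail {y : 𝔸} (hy : ‖y‖ < 1) : HasSum (fun n => logTailCoeff n • y ^ n) (logTail y) := by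
  unfold logTail
  have h := (FormalMultilinearSeries.ofScalars 𝔸 logTailCoeff).hasSum (mem_eball_logTail hy)
  simp only [FormalMultilinearSeries.ofScalars_apply_eq] at h
  exact h

/-- [folklore] The exp tail is analytic everywhere. -/
theorem analyticAt_expTail (y : 𝔸) : AnalyticAt ℂ (expTail : 𝔸 → 𝔸) y :=
  ((FormalMultilinearSeries.ofScalars 𝔸 expTailCoeff).hasFPowerSeriesOnBall
    (by rw [expTail_radius]; exact ENNReal.zero_lt_top)).analyticAt_of_mem (mem_eball_expTail y)

/-- [folklore] The log tail is analytic on the unit ball. -/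
theorem analyticAt_logTail {y : 𝔸} (hy : ‖y‖ < 1) : AnalyticAt ℂ (logTail : 𝔸 → 𝔸) y :=
  ((FormalMultilinearSeries.ofScalars 𝔸 logTailCoeff).hasFPowerSeriesOnBall
    (lt_of_lt_of_le zero_lt_one one_le_logTail_radius)).analyticAt_of_mem (mem_eball_logTail hy)

/-- [folklore] THE ORDER-4 SPLIT OF THE EXPONENTIAL SERIES: `exp y = 1 + y + y²/2 + y³/6 + y⁴·expTail y`. -/
theorem exp_eq_trunc_add_tail (y : 𝔸) : NormedSpace.exp y
    = 1 + y + (2 : ℂ)⁻¹ • (y * y) + (6 : ℂ)⁻¹ • (y * y * y) + y * y * y * y * expTail y := by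
  have h := NormedSpace.exp_series_hasSum_exp' (𝕂 := ℂ) y
  have h4 := (hasSum_nat_add_iff' 4).2 h
  have e : ∀ n : ℕ, (((n + 4)! : ℕ) : ℂ)⁻¹ • y ^ (n + 4) = y * y * y * y * (expTailCoeff n • y ^ n) := by
    intro n
    rw [expTailCoeff, mul_smul_comm, pow_add, pow_mul_comm]
    congr 2
    simp only [pow_succ, pow_zero, one_mul, mul_assoc]
  simp_rw [e] at h4
  have ht := (hasSum_expTail y).mul_left (y * y * y * y)
  have hs : ∑ i ∈ Finset.range 4, ((i ! : ℕ) : ℂ)⁻¹ • y ^ i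
      = 1 + y + (2 : ℂ)⁻¹ • (y * y) + (6 : ℂ)⁻¹ • (y * y * y) := by
    simp only [Finset.sum_range_succ, Finset.sum_range_zero, zero_add, pow_zero, pow_succ, one_mul,
      Nat.factorial, Nat.cast_one, inv_one, one_smul, mul_one, mul_assoc]
    norm_num
  rw [← hs]
  exact sub_eq_iff_eq_add'.1 (h4.unique ht)

/-- [folklore] THE ORDER-4 SPLIT OF THE LOGARITHMIC SERIES on `‖y‖ < 1`:
`log (1 + y) = y − y²/2 + y³/3 + y⁴·logTail y`. -/
theorem logOnePlus_eq_trunc_add_tail {y : 𝔸} (hy : ‖y‖ < 1) : logOnePlus y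
    = y - (2 : ℂ)⁻¹ • (y * y) + (3 : ℂ)⁻¹ • (y * y * y) + y * y * y * y * logTail y := by
  have h := hasSum_logOnePlus hy
  have h4 := (hasSum_nat_add_iff' 4).2 h
  have e : ∀ n : ℕ, logSeriesCoeff (n + 4) • y ^ (n + 4) = y * y * y * y * (logTailCoeff n • y ^ n) := by
    intro n
    rw [logTailCoeff, mul_smul_comm, pow_add, pow_mul_comm]
    congr 2
    simp only [pow_succ, pow_zero, one_mul, mul_assoc]
  simp_rw [e] at h4
  have ht := (hasSum_logTail hy).mul_left (y * y * y * y)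
  have hs : ∑ i ∈ Finset.range 4, logSeriesCoeff i • y ^ i
      = y - (2 : ℂ)⁻¹ • (y * y) + (3 : ℂ)⁻¹ • (y * y * y) := by
    simp only [Finset.sum_range_succ, Finset.sum_range_zero, zero_add, pow_zero, pow_succ, one_mul,
      logSeriesCoeff, mul_assoc]
    norm_num
    module
  rw [← hs]
  exact sub_eq_iff_eq_add'.1 (h4.unique ht)

/-! ## §2 Jets through `exp`, `log (1 + ·)`, `(·)⁻¹` -/

section JetCalculus

variable {h g : P3 → 𝔸} {q : Rho 𝔸}

omit [CompleteSpace 𝔸] in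
/-- The fourth power of a germ vanishing at `0` to first order is flat (`Rho.nil4`). -/
theorem pow4_mem_flat (hh : q ∈ jets h) (hq : c00 q.fst = 0) : (fun x => h x * h x * h x * h x) ∈ flat := by
  have h4 := mem_jets.1 (mul_mem_jets (mul_mem_jets (mul_mem_jets hh hh) hh) hh)
  rw [Rho.nil4 q hq] at h4
  simpa using h4

/-- [folklore] `exp` ON JETS: if `q` is the jet of `h` and `h(0) = 0` then `expT ℂ q` is the jet of `exp ∘ h`. -/
theorem exp_mem_jets (hh : q ∈ jets h) (hq : c00 q.fst = 0) :
    expT ℂ q ∈ jets (fun x => NormedSpace.exp (h x)) := by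
  have hp : expT ℂ q ∈ jets (fun x => 1 + h x + (2 : ℂ)⁻¹ • (h x * h x) + (6 : ℂ)⁻¹ • (h x * h x * h x)) := by
    rw [expT]
    exact add_mem_jets (add_mem_jets (add_mem_jets one_mem_jets hh) (smul_mem_jets _ (mul_mem_jets hh hh)))
      (smul_mem_jets _ (mul_mem_jets (mul_mem_jets hh hh) hh))
  have ha : AnalyticAt ℂ (fun x => expTail (h x)) 0 :=
    (analyticAt_expTail (h 0)).fun_comp (analyticAt_of_mem_jets hh)
  have ht : (fun x => h x * h x * h x * h x * expTail (h x)) ∈ flat := flat_mul_right (pow4_mem_flat hh hq) ha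
  refine mem_jets.2 (flat_congr (flat_add (mem_jets.1 hp) ht) (Eventually.of_forall fun x => ?_))
  rw [exp_eq_trunc_add_tail (h x)]
  abel

omit [CompleteSpace 𝔸] in
/-- Near `0`, a germ with `g(0) = 1` stays in the ball `‖g − 1‖ < 1`. -/
theorem eventually_norm_sub_one_lt (hg : q ∈ jets g) (h1 : c00 q.fst = 1) :
    ∀ᶠ x in 𝓝 (0 : P3), ‖g x - 1‖ < 1 := by
  have hc : ContinuousAt (fun x => ‖g x - 1‖) 0 :=
    ((analyticAt_of_mem_jets hg).continuousAt.sub continuousAt_const).norm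
  have h0 : ‖g 0 - 1‖ < 1 := by rw [apply_zero_of_mem_jets hg, h1, sub_self, norm_zero]; exact zero_lt_one
  exact hc.eventually_lt continuousAt_const h0

/-- [folklore] `log (1 + ·)` ON JETS: if `q` is the jet of `g` and `g(0) = 1` then `logT ℂ q` is the jet of
`x ↦ log (1 + (g x − 1))` (the tree's `logOnePlus`). -/
theorem logOnePlus_mem_jets (hg : q ∈ jets g) (h1 : c00 q.fst = 1) :
    logT ℂ q ∈ jets (fun x => logOnePlus (g x - 1)) := by
  have hn : q - 1 ∈ jets (fun x => g x - 1) := sub_mem_jets hg one_mem_jets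
  have hn0 : c00 (q - 1).fst = 0 := by simp [h1]
  have hp : logT ℂ q ∈ jets (fun x => (g x - 1) - (2 : ℂ)⁻¹ • ((g x - 1) * (g x - 1))
      + (3 : ℂ)⁻¹ • ((g x - 1) * (g x - 1) * (g x - 1))) := by
    rw [logT]
    exact add_mem_jets (sub_mem_jets hn (smul_mem_jets _ (mul_mem_jets hn hn)))
      (smul_mem_jets _ (mul_mem_jets (mul_mem_jets hn hn) hn))
  have hg0 : g 0 - 1 = 0 := by rw [apply_zero_of_mem_jets hg, h1, sub_self]
  have ha : AnalyticAt ℂ (fun x => logTail (g x - 1)) 0 :=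
    AnalyticAt.fun_comp (f := fun x => g x - 1) (x := 0)
      (analyticAt_logTail (y := g 0 - 1) (by rw [hg0, norm_zero]; exact zero_lt_one)) (analyticAt_of_mem_jets hn)
  have ht : (fun x => (g x - 1) * (g x - 1) * (g x - 1) * (g x - 1) * logTail (g x - 1)) ∈ flat :=
    flat_mul_right (pow4_mem_flat hn hn0) ha
  refine mem_jets.2 (flat_congr (flat_add (mem_jets.1 hp) ht) ?_)
  filter_upwards [eventually_norm_sub_one_lt hg h1] with x hx
  rw [logOnePlus_eq_trunc_add_tail hx]
  abel

/-- [folklore] INVERSION ON JETS: if `q` is the jet of `g` and `g(0) = 1` then node 12's truncated geometric series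
`invT q` is the jet of `x ↦ (g x)⁻¹` (`Ring.inverse`; `g x` is a unit near `0`). -/
theorem inverse_mem_jets (hg : q ∈ jets g) (h1 : c00 q.fst = 1) :
    invT q ∈ jets (fun x => Ring.inverse (g x)) := by
  have hn : q - 1 ∈ jets (fun x => g x - 1) := sub_mem_jets hg one_mem_jets
  have hn0 : c00 (q - 1).fst = 0 := by simp [h1]
  have hp : invT q ∈ jets (fun x => 1 - (g x - 1) + (g x - 1) * (g x - 1)
      - (g x - 1) * (g x - 1) * (g x - 1)) := by
    rw [invT]
    exact sub_mem_jets (add_mem_jets (sub_mem_jets one_mem_jets hn) (mul_mem_jets hn hn))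
      (mul_mem_jets (mul_mem_jets hn hn) hn)
  have hu0 : IsUnit (g 0) := by
    have : g 0 = 1 := by rw [apply_zero_of_mem_jets hg, h1]
    rw [this]; exact isUnit_one
  have ha : AnalyticAt ℂ (fun x => Ring.inverse (g x)) 0 := by
    have hi : AnalyticAt ℂ Ring.inverse (g 0) := by
      simpa using analyticAt_inverse (𝕜 := ℂ) hu0.unit
    exact hi.fun_comp (analyticAt_of_mem_jets hg)
  have ht : (fun x => (g x - 1) * (g x - 1) * (g x - 1) * (g x - 1) * Ring.inverse (g x)) ∈ flat :=
    flat_mul_right (pow4_mem_flat hn hn0) ha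
  refine mem_jets.2 (flat_congr (flat_add (mem_jets.1 hp) ht) ?_)
  filter_upwards [eventually_norm_sub_one_lt hg h1] with x hx
  have hu : IsUnit (g x) := isUnit_of_norm_sub_one_lt_one' hx
  -- `invT u · u = 1 − (u−1)⁴` (node 12), times `u⁻¹` on the right
  have key : 1 - (g x - 1) + (g x - 1) * (g x - 1) - (g x - 1) * (g x - 1) * (g x - 1)
      = Ring.inverse (g x) - (g x - 1) * (g x - 1) * (g x - 1) * (g x - 1) * Ring.inverse (g x) := by
    have e2 : invT (g x) * g x * Ring.inverse (g x)
        = (1 - (g x - 1) * (g x - 1) * (g x - 1) * (g x - 1)) * Ring.inverse (g x) := by rw [invT_mul]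
    rw [mul_assoc, Ring.mul_inverse_cancel _ hu, mul_one, invT,
      sub_mul (1 : 𝔸) ((g x - 1) * (g x - 1) * (g x - 1) * (g x - 1)) (Ring.inverse (g x)), one_mul] at e2
    exact e2
  rw [key]
  abel

/-- [folklore] The COMBINATION THAT DEFINES NODE 12's `Qjet`: for germs `U`, `E` with jets `Φ_U`, `Φ_E` and
`U(0) = E(0) = 1`, the jet of `x ↦ log (U x · (E x)⁻¹)` (as `logOnePlus (U E⁻¹ − 1)`) is `logT (Φ_U · invT Φ_E)`. -/
theorem logOnePlus_mul_inverse_mem_jets {U E : P3 → 𝔸} {ΦU ΦE : Rho 𝔸} (hU : ΦU ∈ jets U) (hE : ΦE ∈ jets E)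
    (hU1 : c00 ΦU.fst = 1) (hE1 : c00 ΦE.fst = 1) :
    logT ℂ (ΦU * invT ΦE) ∈ jets (fun x => logOnePlus (U x * Ring.inverse (E x) - 1)) := by
  have hm : ΦU * invT ΦE ∈ jets (fun x => U x * Ring.inverse (E x)) := mul_mem_jets hU (inverse_mem_jets hE hE1)
  have h1 : c00 (ΦU * invT ΦE).fst = 1 := by
    have hφ : c00 (invT ΦE).fst = 1 := by
      rw [invT]
      simp [hE1]
    simp [hU1, hφ]
  exact logOnePlus_mem_jets hm h1

end JetCalculus

end Summit.QuantumFields.BalabanUV.Beta.MultilinearJet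

end
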